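import Literature.MathematicalPhysics.QuantumChemistry.EnsembleExclusionPrinciple
import Literature.MathematicalPhysics.QuantumChemistry.SecondQuantizedHamiltonian
import HarnessLib

/-!
# Level-shift deflation: a lower bound on the shifted form `A + λ(G − c)` is a lower bound on `A`
# orthogonal to the deflator's top vector; occupation-number deflators on a spin sector

Topic `Literature/MathematicalPhysics/QuantumChemistry`; companion of `EnsembleExclusionPrinciple.lean`
(§1 there: `N̂_S ≤ (N − 1) + |S⟩⟨S|` on the `N`-particle sector) and of the Kato–Temple apparatus
`QuantumLattice/GroundStateEnclosureCertificate.lean` (`TempleKato.exists_codimOne_of_vector_certificate`: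
a form bound `σ‖x‖² ≤ Re⟨x, A x⟩` on `K ∩ v^⊥` is a certificate that `λ₂(A|_K) ≥ σ`). PROVED, no
definition, no named fact, no instance.

The classical fact typed here is the interlacing theorem for a rank-one positive perturbation,
Horn–Johnson Cor. 4.3.9 (eq. (4.3.10)): «Let `A ∈ M_n` be Hermitian and let `z ∈ ℂⁿ` be nonzero. Then
`λ_i(A) ≤ λ_i(A + zz*) ≤ λ_{i+1}(A)`», in the variational form a certificate pipeline uses: if a
Hermitian "deflator" `G` satisfies `G ≤ c` on `K ∩ v^⊥` (so `λ(G − c) ≤ (const)·vv*` on `K`), then for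
`λ ≥ 0` any lower bound `σ` of the form of the SHIFTED operator `A + λ(G − c·1)` on `K` is a lower bound
of the form of `A` on `K ∩ v^⊥` — hence `σ ≤ λ₂(A|_K)`; the shifted operator is again of the same
algebraic class as `A` when `G` is one-body, so `σ` can come from any ground-energy lower-bound method.

* §1 `form_ge_on_orth_of_deflator` — the three-line deflation lemma above (generic finite index type),
  plus the variant with the shift written inside one matrix (`…_of_deflator_matrix`).
* §2 `sum_numberAt_form_le_on_orth_single` / `form_ge_on_orth_single_of_levelShift` — the deflator
  `G = N̂_S` (`c = N − 1`, `v = |S⟩`) on any subspace of `N`-particle vectors, from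
  `re_expect_sum_numberAt_le_of_apply_eq_zero`; sector form `…_of_isInSector`.
* §3 spin-free WEIGHTED occupation deflators on the `(N_α, N_β) = (a, b)` sector of `Fock (Orb Λ)`:
  `G_w = Σ_p w_p E_pp` (`E_pp = n_{p↑} + n_{p↓}`, the tree's `singletExcitation p p`) is diagonal on
  determinants with value `g(s) = Σ_{p ∈ upPart s} w_p + Σ_{p ∈ downPart s} w_p`
  (`re_expect_weightedNumber`); if the `a`-set `T_α` and the `b`-set `T_β` beat every other set of the
  same size by a margin `δ ≥ 0` (hypotheses `hα`, `hβ`; the venture file `Rows/LevelShiftGapRows.lean`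
  discharges them from weight THRESHOLDS, a `k`-term check), then with `M = Σ_{T_α} w + Σ_{T_β} w` and
  `D⋆ = |T_α↑ T_β↓⟩`: `Re⟨x, G_w x⟩ ≤ (M − δ)‖x‖² + δ|x_{D⋆}|²` for every sector vector
  (`re_expect_weightedNumber_le`), so `G_w ≤ M − δ` on the sector orthogonally to `D⋆`
  (`weightedNumber_form_le_on_orth_det`) and the level-shift producer `form_ge_on_orth_det_of_levelShift`.
  Closed shell (`w = 1_J`, `a = b = |J|`): `M − δ = N − 1`; high-spin reference (`w = 2` on the doubly,
  `1` on the singly occupied set): `M − δ = a + 3b − 1` (chem-idea-1 2026-08-26).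

USE (cell chem-oracle, door M1, β-producer of record = level-shift deflation, chem-idea-1 21:40:54Z):
`Summits/Ventures/CertifiedQuantumChemistry/Rows/GapCertificateCodimOne.lean`
(`gapCertificateCodimOne_of_lowerRow_shift`, chem-type-09) takes exactly the conclusion of §2/§3 as its
hypothesis `hSform` for the shift table `S = F_w`; the venture-side instantiation is
`Rows/LevelShiftGapRows.lean`.

NOT here: the unitarily-invariant (natural-orbital) deflator; two-body (CSF-aware) deflators for
open-shell singlets; anything about a particular Hamiltonian or file.

## Tree search
`lean search 'codimOne|rankOne_certificate|levelShift|deflat'`: REUSED `TempleKato.*`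
(`GroundStateEnclosureCertificate`), `numberAt_eq_diagonal`, `singletExcitation`, `upPart`/`downPart`/
`pairSet` (`HubbardLiebConfig`), `IsInSector`; venture consumers `GapCertificateCodimOne`,
`gapCertificateCodimOne_of_lowerRow_shift` (not imported here: Literature may not import Summits).
No level-shift / deflation lemma existed under `Literature/`.

## References
* R. A. Horn, C. R. Johnson, *Matrix Analysis*, 2nd ed. (CUP 2013), Cor. 4.3.9 eq. (4.3.10) (interlacing
  for a rank-one Hermitian perturbation), Thm 4.2.6 (Courant–Fischer). [cite: HornJohnson2013, Cor. 4.3.9]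
* C. Schilling, S. Pittalis, Phys. Rev. Lett. 127 (2021) 023001, arXiv:2106.02560 p. 4 (configuration
  ordering `i₁ = (1,…,N)`, `i₂`: the occupation count behind §2–§3). [cite: SchillingPittalis2021, arXiv p. 4]
* T. Helgaker, P. Jørgensen, J. Olsen, *Molecular Electronic-Structure Theory* (2000), eq. (2.2.7)
  (`E_pq`; the tree's `singletExcitation`). [cite: HelgakerJorgensenOlsen2000, eq. (2.2.7)]
-/

noncomputable section

namespace Literature.MathematicalPhysics.QuantumChemistry

open Matrix Finset Literature.MathematicalPhysics.QuantumLattice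
open scoped ComplexOrder

/-! ### §1 The deflation lemma -/

section Deflator

variable {n : Type*} [Fintype n] [DecidableEq n]

/-- The form of the shifted operator splits: `Re⟨x, (A + λ(G − c·1))x⟩ = Re⟨x,Ax⟩ + λ(Re⟨x,Gx⟩ − c‖x‖²)`
for real `λ`, `c`. [folklore] -/
private theorem re_form_shift (A G : Matrix n n ℂ) (lam c : ℝ) (x : n → ℂ) :
    (star x ⬝ᵥ (A + (lam : ℂ) • (G - (c : ℂ) • (1 : Matrix n n ℂ))) *ᵥ x).re =
      (star x ⬝ᵥ A *ᵥ x).re + lam * ((star x ⬝ᵥ G *ᵥ x).re - c * (star x ⬝ᵥ x).re) := by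
  rw [add_mulVec, smul_mulVec, sub_mulVec, smul_mulVec, one_mulVec, dotProduct_add,
    dotProduct_smul, dotProduct_sub, dotProduct_smul, smul_eq_mul, smul_eq_mul, Complex.add_re,
    Complex.re_ofReal_mul, Complex.sub_re, Complex.re_ofReal_mul]

omit [DecidableEq n] in
/-- **Level-shift deflation** (variational form of interlacing under a rank-one perturbation,
Horn–Johnson Cor. 4.3.9: «`λ_i(A) ≤ λ_i(A + zz*) ≤ λ_{i+1}(A)`»). Let `G` be a "deflator" whose form is
`≤ c` on the part of `K` orthogonal to one vector `v` (`G − c ≤ 0` on `K ∩ v^⊥`), and `λ ≥ 0`. If `σ`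
bounds the form of `A` shifted by `λ(G − c)` from below on ALL of `K`
(`σ‖x‖² ≤ Re⟨x,Ax⟩ + λ(Re⟨x,Gx⟩ − c‖x‖²)`, e.g. `σ ≤ λ₁((A + λ(G − c))|_K)`), then `σ‖x‖² ≤ Re⟨x, A x⟩`
for every `x ∈ K` orthogonal to `v` — the hypothesis `hv` of
`TempleKato.exists_codimOne_of_vector_certificate`, i.e. `σ ≤ λ₂(A|_K)`. Delta vs print: quadratic
forms on a subspace `K`, the rank-one perturbation replaced by any `G` dominated off `v`.
[cite: HornJohnson2013, Cor. 4.3.9] -/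
theorem form_ge_on_orth_of_deflator {A G : Matrix n n ℂ} {K : Submodule ℂ (n → ℂ)} {v : n → ℂ}
    {lam c σ : ℝ} (hlam : 0 ≤ lam)
    (hG : ∀ x ∈ K, star v ⬝ᵥ x = 0 → (star x ⬝ᵥ G *ᵥ x).re ≤ c * (star x ⬝ᵥ x).re)
    (hσ : ∀ x ∈ K, σ * (star x ⬝ᵥ x).re ≤
      (star x ⬝ᵥ A *ᵥ x).re + lam * ((star x ⬝ᵥ G *ᵥ x).re - c * (star x ⬝ᵥ x).re)) :
    ∀ x ∈ K, star v ⬝ᵥ x = 0 → σ * (star x ⬝ᵥ x).re ≤ (star x ⬝ᵥ A *ᵥ x).re := by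
  intro x hx hvx
  have h1 := hσ x hx
  have h2 : lam * ((star x ⬝ᵥ G *ᵥ x).re - c * (star x ⬝ᵥ x).re) ≤ 0 :=
    mul_nonpos_of_nonneg_of_nonpos hlam (sub_nonpos.2 (hG x hx hvx))
  linarith

/-- **Level-shift deflation, matrix form**: the same with the shift written as one operator
`A + λ(G − c·1)` (the "shifted Hamiltonian" whose ground-energy lower bound a certificate supplies).
[cite: HornJohnson2013, Cor. 4.3.9] -/
theorem form_ge_on_orth_of_deflator_matrix {A G : Matrix n n ℂ} {K : Submodule ℂ (n → ℂ)}
    {v : n → ℂ} {lam c σ : ℝ} (hlam : 0 ≤ lam)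
    (hG : ∀ x ∈ K, star v ⬝ᵥ x = 0 → (star x ⬝ᵥ G *ᵥ x).re ≤ c * (star x ⬝ᵥ x).re)
    (hσ : ∀ x ∈ K, σ * (star x ⬝ᵥ x).re ≤
      (star x ⬝ᵥ (A + (lam : ℂ) • (G - (c : ℂ) • (1 : Matrix n n ℂ))) *ᵥ x).re) :
    ∀ x ∈ K, star v ⬝ᵥ x = 0 → σ * (star x ⬝ᵥ x).re ≤ (star x ⬝ᵥ A *ᵥ x).re :=
  form_ge_on_orth_of_deflator hlam hG fun x hx => by rw [← re_form_shift]; exact hσ x hx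

/-- With a Hermitian shifted operator, a lower bound `σ ≤ λ₁((A + λ(G − c))|_K)` on its lowest energy in
`K` is the hypothesis `hσ` (variational principle `minEnergyOn_mul_le_re_rayleigh`).
[cite: HornJohnson2013, Cor. 4.3.9] -/
theorem form_ge_on_orth_of_deflator_minEnergyOn {A G : Matrix n n ℂ} (hA : A.IsHermitian)
    (hGh : G.IsHermitian) {K : Submodule ℂ (n → ℂ)} {v : n → ℂ} {lam c σ : ℝ} (hlam : 0 ≤ lam)
    (hG : ∀ x ∈ K, star v ⬝ᵥ x = 0 → (star x ⬝ᵥ G *ᵥ x).re ≤ c * (star x ⬝ᵥ x).re)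
    (hσ : σ ≤ (A + (lam : ℂ) • (G - (c : ℂ) • (1 : Matrix n n ℂ))).minEnergyOn K) :
    ∀ x ∈ K, star v ⬝ᵥ x = 0 → σ * (star x ⬝ᵥ x).re ≤ (star x ⬝ᵥ A *ᵥ x).re := by
  have hGc : (G - (c : ℂ) • (1 : Matrix n n ℂ)).IsHermitian := by
    refine hGh.sub ?_
    rw [IsHermitian, conjTranspose_smul, conjTranspose_one, Complex.star_def, Complex.conj_ofReal]
  have hH : (A + (lam : ℂ) • (G - (c : ℂ) • (1 : Matrix n n ℂ))).IsHermitian := by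
    refine hA.add ?_
    rw [IsHermitian, conjTranspose_smul, hGc.eq, Complex.star_def, Complex.conj_ofReal]
  refine form_ge_on_orth_of_deflator_matrix hlam hG fun x hx => ?_
  exact (mul_le_mul_of_nonneg_right hσ (EigenvalueContinuation.re_star_dotProduct_self_nonneg x)).trans
    (minEnergyOn_mul_le_re_rayleigh hH K hx)

end Deflator

/-! ### §2 The deflator `N̂_S` (occupation of `N` chosen spin orbitals) -/

section NumberSet

variable {ι : Type*} [LinearOrder ι] [Fintype ι]

/-- `⟨S|x⟩ = x_S` for the determinant `|S⟩ = Pi.single S 1`. [folklore] -/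
private theorem star_single_dotProduct' (S : Finset ι) (x : Fock ι) :
    star (Pi.single S (1 : ℂ)) ⬝ᵥ x = x S := by
  rw [← Pi.single_star, star_one, single_dotProduct, one_mul]

/-- **`N̂_S ≤ N − 1` orthogonally to `|S⟩`** on any subspace `K` of `N`-particle vectors: for
`x ∈ K ∩ |S⟩^⊥` and `|S| = N`, `Re⟨x, N̂_S x⟩ ≤ (N − 1)‖x‖²` — the hypothesis `hG` of
`form_ge_on_orth_of_deflator` with `G = N̂_S`, `c = N − 1`, `v = |S⟩`
(`EnsembleExclusionPrinciple.re_expect_sum_numberAt_le_of_apply_eq_zero`).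
[cite: SchillingPittalis2021, arXiv p. 4 (vertex v⁽¹⁾)] -/
theorem sum_numberAt_form_le_on_orth_single {K : Submodule ℂ (Fock ι)} {N : ℕ}
    (hK : ∀ x ∈ K, IsNParticle N x) {S : Finset ι} (hS : S.card = N) :
    ∀ x ∈ K, star (Pi.single S (1 : ℂ)) ⬝ᵥ x = 0 →
      (star x ⬝ᵥ (∑ p ∈ S, numberAt p) *ᵥ x).re ≤ ((N : ℝ) - 1) * (star x ⬝ᵥ x).re := by
  intro x hx h0
  rw [star_single_dotProduct'] at h0
  exact re_expect_sum_numberAt_le_of_apply_eq_zero (hK x hx) hS h0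

/-- **Level-shift gap producer with the deflator `N̂_S`.** On a subspace `K` of `N`-particle vectors,
if `σ‖x‖² ≤ Re⟨x, A x⟩ + λ(Re⟨x, N̂_S x⟩ − (N − 1)‖x‖²)` on `K` for some `λ ≥ 0` and an `N`-set `S`
(a lower bound for the Hamiltonian shifted by `λ(N̂_S − (N − 1))`, a one-body diagonal shift), then
`σ‖x‖² ≤ Re⟨x, A x⟩` on `K ∩ |S⟩^⊥`, hence `σ ≤ λ₂(A|_K)` via
`TempleKato.exists_codimOne_of_vector_certificate` / `gap_of_codimOne_certificate`.
[cite: HornJohnson2013, Cor. 4.3.9] -/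
theorem form_ge_on_orth_single_of_levelShift {A : Matrix (Finset ι) (Finset ι) ℂ}
    {K : Submodule ℂ (Fock ι)} {N : ℕ} (hK : ∀ x ∈ K, IsNParticle N x) {S : Finset ι}
    (hS : S.card = N) {lam σ : ℝ} (hlam : 0 ≤ lam)
    (hσ : ∀ x ∈ K, σ * (star x ⬝ᵥ x).re ≤ (star x ⬝ᵥ A *ᵥ x).re +
      lam * ((star x ⬝ᵥ (∑ p ∈ S, numberAt p) *ᵥ x).re - ((N : ℝ) - 1) * (star x ⬝ᵥ x).re)) :
    ∀ x ∈ K, star (Pi.single S (1 : ℂ)) ⬝ᵥ x = 0 →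
      σ * (star x ⬝ᵥ x).re ≤ (star x ⬝ᵥ A *ᵥ x).re :=
  form_ge_on_orth_of_deflator hlam (sum_numberAt_form_le_on_orth_single hK hS) hσ

end NumberSet

section NumberSetSector

variable {Λ : Type*} [LinearOrder Λ] [Fintype Λ]

/-- **Sector form of §2.** In the `(N_α, N_β) = (a, b)` sector of `Fock (Orb Λ)` (every sector vector
is an `(a + b)`-particle vector, `IsInSector.isNParticle`), for an `(a + b)`-set `S` of spin orbitals:
`Re⟨x, N̂_S x⟩ ≤ (a + b − 1)‖x‖²` whenever `IsInSector a b x` and `x_S = 0`.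
[cite: SchillingPittalis2021, arXiv p. 4 (vertex v⁽¹⁾)] -/
theorem sum_numberAt_form_le_of_isInSector {a b : ℕ} {S : Finset (Orb Λ)} (hS : S.card = a + b)
    (x : Fock (Orb Λ)) (hx : IsInSector a b x) (h0 : star (Pi.single S (1 : ℂ)) ⬝ᵥ x = 0) :
    (star x ⬝ᵥ (∑ p ∈ S, numberAt p) *ᵥ x).re ≤ (((a + b : ℕ) : ℝ) - 1) * (star x ⬝ᵥ x).re :=
  sum_numberAt_form_le_on_orth_single (K := szSector (a + b) (((a : ℝ) - b) / 2))
    (fun y hy => ((mem_szSector_iff_isInSector a b y).1 hy).isNParticle) hS x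
    ((mem_szSector_iff_isInSector a b x).2 hx) h0

end NumberSetSector

/-! ### §3 Spin-free weighted occupation deflators on the `(a, b)` sector -/

section Weighted

variable {Λ : Type*} [LinearOrder Λ] [Fintype Λ]

/-- `G_w = Σ_p w_p E_pp` is diagonal on determinants with value
`g(s) = Σ_{p ∈ upPart s} w_p + Σ_{p ∈ downPart s} w_p` (each `n_{pσ}` is diagonal with entry
`[pσ ∈ s]`, `numberAt_eq_diagonal`). Helgaker–Jørgensen–Olsen eq. (2.2.7) (`E_pp = Σ_σ a†_{pσ}a_{pσ}`).
[cite: HelgakerJorgensenOlsen2000, eq. (2.2.7)] -/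
theorem weightedNumber_eq_diagonal (w : Λ → ℝ) :
    ∑ p, ((w p : ℝ) : ℂ) • singletExcitation p p =
      diagonal fun s : Finset (Orb Λ) =>
        (((∑ p ∈ upPart s, w p + ∑ p ∈ downPart s, w p : ℝ)) : ℂ) := by
  ext s t
  simp only [Matrix.sum_apply, Matrix.smul_apply, singletExcitation, Fin.sum_univ_two, Matrix.add_apply,
    smul_eq_mul, diagonal_apply]
  have hn : ∀ q : Orb Λ, (creation q * annihilation q) s t = if s = t then (if q ∈ s then 1 else 0) else 0 := by
    intro q
    have := congrFun (congrFun (numberAt_eq_diagonal (ι := Orb Λ) q) s) t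
    rwa [numberAt, diagonal_apply] at this
  simp only [hn]
  by_cases hst : s = t
  · subst hst
    simp only [if_true]
    rw [Complex.ofReal_add, Complex.ofReal_sum, Complex.ofReal_sum, upPart, downPart, Finset.sum_filter,
      Finset.sum_filter, ← Finset.sum_add_distrib]
    refine Finset.sum_congr rfl fun p _ => ?_
    simp only [mul_add, mul_ite, mul_one, mul_zero]
  · simp [hst]

/-- `Re⟨x, G_w x⟩ = Σ_s g(s)|x_s|²` with `g(s) = Σ_{p∈upPart s} w_p + Σ_{p∈downPart s} w_p`.
[cite: HelgakerJorgensenOlsen2000, eq. (2.2.7)] -/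
theorem re_expect_weightedNumber (w : Λ → ℝ) (x : Fock (Orb Λ)) :
    (star x ⬝ᵥ (∑ p, ((w p : ℝ) : ℂ) • singletExcitation p p) *ᵥ x).re =
      ∑ s, (∑ p ∈ upPart s, w p + ∑ p ∈ downPart s, w p) * ‖x s‖ ^ 2 := by
  rw [weightedNumber_eq_diagonal]
  simp only [dotProduct, mulVec_diagonal, Pi.star_apply, Complex.re_sum]
  refine Finset.sum_congr rfl fun s _ => ?_
  rw [mul_left_comm, Complex.star_def, ← Complex.normSq_eq_conj_mul_self, Complex.normSq_eq_norm_sq]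
  norm_cast

/-- **Weighted occupation bound on the `(a, b)` sector** (the spin-free analogue of
`N̂_S ≤ (N − 1) + |S⟩⟨S|`): let `T_α` (`|T_α| = a`) and `T_β` (`|T_β| = b`) beat every other orbital
set of their sizes by the margin `δ ≥ 0` in total weight, `M = Σ_{T_α} w + Σ_{T_β} w`, and
`D⋆ = |T_α↑ T_β↓⟩`. Then for every vector `x` supported on the `(a, b)` sector,
`Re⟨x, G_w x⟩ ≤ (M − δ)‖x‖² + δ|x_{D⋆}|²` (`G_w` takes the value `M` on `D⋆` and `≤ M − δ` on every
other sector determinant). [cite: SchillingPittalis2021, arXiv p. 4 (vertex v⁽¹⁾)] -/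
theorem re_expect_weightedNumber_le {w : Λ → ℝ} {a b : ℕ} {Tα Tβ : Finset Λ} (hTa : Tα.card = a)
    (hTb : Tβ.card = b) {δ : ℝ} (hδ : 0 ≤ δ)
    (hα : ∀ α : Finset Λ, α.card = Tα.card → α ≠ Tα → ∑ p ∈ α, w p + δ ≤ ∑ p ∈ Tα, w p)
    (hβ : ∀ β : Finset Λ, β.card = Tβ.card → β ≠ Tβ → ∑ p ∈ β, w p + δ ≤ ∑ p ∈ Tβ, w p)
    (x : Fock (Orb Λ)) (hx : IsInSector a b x) :
    (star x ⬝ᵥ (∑ p, ((w p : ℝ) : ℂ) • singletExcitation p p) *ᵥ x).re ≤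
      (∑ p ∈ Tα, w p + ∑ p ∈ Tβ, w p - δ) * (star x ⬝ᵥ x).re + δ * ‖x (pairSet Tα Tβ)‖ ^ 2 := by
  classical
  rw [re_expect_weightedNumber, EigenvalueContinuation.re_star_dotProduct_self, Finset.mul_sum]
  have hsingle : δ * ‖x (pairSet Tα Tβ)‖ ^ 2 =
      ∑ s, if s = pairSet Tα Tβ then δ * ‖x s‖ ^ 2 else 0 := by
    rw [Finset.sum_ite_eq', if_pos (Finset.mem_univ _)]
  rw [hsingle, ← Finset.sum_add_distrib]
  refine Finset.sum_le_sum fun s _ => ?_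
  by_cases hsD : s = pairSet Tα Tβ
  · subst hsD
    rw [if_pos rfl, upPart_pairSet, downPart_pairSet]
    linarith
  · rw [if_neg hsD, add_zero]
    by_cases hsec : (upPart s).card = a ∧ (downPart s).card = b
    · have hg : ∑ p ∈ upPart s, w p + ∑ p ∈ downPart s, w p ≤ ∑ p ∈ Tα, w p + ∑ p ∈ Tβ, w p - δ := by
        have hparts : upPart s ≠ Tα ∨ downPart s ≠ Tβ := by
          by_contra h
          push Not at h
          exact hsD (by rw [← pairSet_upPart_downPart s, h.1, h.2])
        have hupw : ∑ p ∈ upPart s, w p ≤ ∑ p ∈ Tα, w p := by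
          by_cases hu : upPart s = Tα
          · rw [hu]
          · linarith [hα (upPart s) (by rw [hsec.1, hTa]) hu]
        have hdnw : ∑ p ∈ downPart s, w p ≤ ∑ p ∈ Tβ, w p := by
          by_cases hd : downPart s = Tβ
          · rw [hd]
          · linarith [hβ (downPart s) (by rw [hsec.2, hTb]) hd]
        rcases hparts with hu | hd
        · linarith [hα (upPart s) (by rw [hsec.1, hTa]) hu]
        · linarith [hβ (downPart s) (by rw [hsec.2, hTb]) hd]
      exact mul_le_mul_of_nonneg_right hg (sq_nonneg _)
    · rw [hx s hsec, norm_zero]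
      simp

/-- `⟨D⋆|x⟩ = x_{D⋆}` for the determinant basis vector. [folklore] -/
private theorem star_single_dotProduct_orb (D : Finset (Orb Λ)) (x : Fock (Orb Λ)) :
    star (Pi.single D (1 : ℂ)) ⬝ᵥ x = x D := by
  rw [← Pi.single_star, star_one, single_dotProduct, one_mul]

/-- **`G_w ≤ M − δ` on the sector orthogonally to `D⋆`** — the hypothesis `hG`/`hSform` of the
level-shift producer with the spin-free weighted deflator `G_w = Σ_p w_p E_pp`, `c = M − δ`,
`v = |D⋆⟩ = |T_α↑ T_β↓⟩`. [cite: SchillingPittalis2021, arXiv p. 4 (vertex v⁽¹⁾)] -/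
theorem weightedNumber_form_le_on_orth_det {w : Λ → ℝ} {a b : ℕ} {Tα Tβ : Finset Λ}
    (hTa : Tα.card = a) (hTb : Tβ.card = b) {δ : ℝ} (hδ : 0 ≤ δ)
    (hα : ∀ α : Finset Λ, α.card = Tα.card → α ≠ Tα → ∑ p ∈ α, w p + δ ≤ ∑ p ∈ Tα, w p)
    (hβ : ∀ β : Finset Λ, β.card = Tβ.card → β ≠ Tβ → ∑ p ∈ β, w p + δ ≤ ∑ p ∈ Tβ, w p)
    (x : Fock (Orb Λ)) (hx : IsInSector a b x) (h0 : star (Pi.single (pairSet Tα Tβ) (1 : ℂ)) ⬝ᵥ x = 0) :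
    (star x ⬝ᵥ (∑ p, ((w p : ℝ) : ℂ) • singletExcitation p p) *ᵥ x).re ≤
      (∑ p ∈ Tα, w p + ∑ p ∈ Tβ, w p - δ) * (star x ⬝ᵥ x).re := by
  have h := re_expect_weightedNumber_le hTa hTb hδ hα hβ x hx
  rw [star_single_dotProduct_orb] at h0
  rwa [h0, norm_zero, zero_pow two_ne_zero, mul_zero, add_zero] at h

/-- **Level-shift gap producer with a spin-free weighted deflator.** In the `(a, b)` sector, with
`T_α, T_β, δ, M` as in `re_expect_weightedNumber_le` and `λ ≥ 0`: a lower bound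
`σ‖x‖² ≤ Re⟨x, A x⟩ + λ(Re⟨x, G_w x⟩ − (M − δ)‖x‖²)` valid on the whole sector (a ground-energy lower
bound for the Hamiltonian with one-body diagonal shift `h_pp ↦ h_pp + λw_p` and constant
`−λ(M − δ)`) gives `σ‖x‖² ≤ Re⟨x, A x⟩` on the sector orthogonally to `|T_α↑ T_β↓⟩`, i.e.
`σ ≤ λ₂(A | sector)`. [cite: HornJohnson2013, Cor. 4.3.9] -/
theorem form_ge_on_orth_det_of_levelShift {A : Matrix (Finset (Orb Λ)) (Finset (Orb Λ)) ℂ}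
    {w : Λ → ℝ} {a b : ℕ} {Tα Tβ : Finset Λ} (hTa : Tα.card = a) (hTb : Tβ.card = b) {δ : ℝ}
    (hδ : 0 ≤ δ)
    (hα : ∀ α : Finset Λ, α.card = Tα.card → α ≠ Tα → ∑ p ∈ α, w p + δ ≤ ∑ p ∈ Tα, w p)
    (hβ : ∀ β : Finset Λ, β.card = Tβ.card → β ≠ Tβ → ∑ p ∈ β, w p + δ ≤ ∑ p ∈ Tβ, w p)
    {lam σ : ℝ} (hlam : 0 ≤ lam)
    (hσ : ∀ x : Fock (Orb Λ), IsInSector a b x → σ * (star x ⬝ᵥ x).re ≤ (star x ⬝ᵥ A *ᵥ x).re +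
      lam * ((star x ⬝ᵥ (∑ p, ((w p : ℝ) : ℂ) • singletExcitation p p) *ᵥ x).re -
        (∑ p ∈ Tα, w p + ∑ p ∈ Tβ, w p - δ) * (star x ⬝ᵥ x).re)) :
    ∀ x : Fock (Orb Λ), IsInSector a b x → star (Pi.single (pairSet Tα Tβ) (1 : ℂ)) ⬝ᵥ x = 0 →
      σ * (star x ⬝ᵥ x).re ≤ (star x ⬝ᵥ A *ᵥ x).re := by
  intro x hx h0
  have h := form_ge_on_orth_of_deflator (K := szSector (a + b) (((a : ℝ) - b) / 2))
    (v := Pi.single (pairSet Tα Tβ) (1 : ℂ)) hlam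
    (fun y hy hy0 => weightedNumber_form_le_on_orth_det hTa hTb hδ hα hβ y
      ((mem_szSector_iff_isInSector a b y).1 hy) hy0)
    (fun y hy => hσ y ((mem_szSector_iff_isInSector a b y).1 hy))
  exact h x ((mem_szSector_iff_isInSector a b x).2 hx) h0

end Weighted

end Literature.MathematicalPhysics.QuantumChemistry

end
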